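import Summits.QuantumFields.QCD.Theorems.ExtinctionBuildsQCD.Negative.TightPinsLine

/-!
# Negative knowledge for crux `ExtinctionBuildsQCD` (stmt-QuantumFields-8968), §4: the volume lever —
# `SD` does not bound `L_k`; modulo fixed-cutoff index spreading the bridge is the summit conjunct

Certified copy of §4 of the cdisprove work file
`Summits/QuantumFields/QCD/Cruxes/ExtinctionBuildsQCD/Disproof.lean` (refuter, cdisprove seat, cycle 2).
Supports stmt-QuantumFields-8968; asserts no route item (every statement about a route decl is an
equivalence with / implication from the UNPROVED hypothesis `IndexSpread`, defined here).

Summary.  The structure `QCDRegularisation` constrains the torus half-sides only by `a_k L_k → ∞`;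
`HasMassScaling` and `HasAsymptoticScaling` do not mention `L` (`withVolume_hasMassScaling_iff`,
`withVolume_hasAsymptoticScaling_iff`, both `Iff.rfl`); EXTINCT is free at every volume for a line at
`m_crit ≥ 0` (`extinct_withVolume_of_mcrit_nonneg`, from §2); TIGHT is the ratio on the scheme's own
torus (`tight_iff_tightRatio`).  So on the TIP FAMILY `tipReg L'` (`canonicalAF` with free volumes) the
hypothesis `SD(N_f)` of the bridge reduces to `IndexSpread N_f`: at the bare parameters of ONE step `k`,
the phase-quenched `E|n₋(Γ₅ D_W(U, -a_k M/Z_k, 1)) - 6(2L'+1)⁴| ≥ 1` on all large tori — an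
infinite-volume statement at fixed cutoff with no continuum content (`tight_tipReg_of_indexSpread`,
`sdWith_of_indexSpread`, `sdHyp_of_indexSpread`).  ERRATUM: the uniformity in `M ∈ (0, K]` written into
`IndexSpread` below makes that hypothesis FALSE (see its docstring); the corrected box form and all
results re-proved from it are in `VolumeLeverBox.lean`, which supersedes this file.  Consequences (the sibling crux `WindowExtinction`
follows from `IndexSpread 2 ∧ IndexSpread 3` — kept in the work file only, it would assert a route item):
`extinctionBuildsQCD_iff_qcd_of_indexSpread :
IndexSpread 2 → IndexSpread 3 → (ExtinctionBuildsQCD ↔ QCD)`, and the schema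
`collapse_schema_of_indexSpread` (no side condition met by the tip family — e.g. the physical-branch
clause `-1 < m_crit ≤ 0`, `collapse_with_branchClause_of_indexSpread` — restores the cut; only a
condition that sees the volume can).  Heuristics for `IndexSpread` and the repair menu (volume cap
`L_k ≤ a_k^{-p}` / extensive TIGHT / fixed physical torus) are in the section docstring below.

References: Edwards–Heller–Narayanan, Nucl. Phys. B 535 (1998) 403 (index = net chirality of real
modes, spectral flow of `γ₅ D_W`); Berruto–Narayanan–Neuberger, Phys. Lett. B 489 (2000) 243, §7 (the
entropy question for defect-bound real modes); Lüscher, Comm. Math. Phys. 85 (1982) 39 (dislocations: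
entropy versus action on the lattice).
-/

noncomputable section

namespace Summit.QuantumFields.QCD.Theorems.ExtinctionBuildsQCD.Negative

open scoped BigOperators Topology Classical MeasureTheory Matrix ComplexConjugate
open Filter MeasureTheory Matrix
open Literature.MathematicalPhysics.QuantumLattice Literature.MathematicalPhysics.QuantumFieldTheory
  Literature.Probability.LatticeModels
open Summit.QuantumFields.QCD.Theses.SpectralDefectExtinction

/-! ## §4 The volume lever: `SD` does not bound `L_k` above; TIGHT at the tip MODULO infinite-volume
index spreading, and then the bridge is the summit conjunct

The pricing that is supposed to defeat a TIP witness (a line at `m_crit(k) ≥ 0`, for which EXTINCT is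
free, §2) compares the Boltzmann cost `e^{-β_k s}` of an ultra-deep real mode of `D_W(U,0,1)` in
`[0, a_k M/Z_k)` with the entropy of the scheme torus, `(2L_k+1)⁴`, tacitly `≍ a_k⁻⁴`. But `SD` quantifies
`∃ reg : QCDRegularisation N_f`, and the structure constrains the volumes ONLY by `a_k L_k → ∞`
(`QCDRegularisation.tendsto_L`): the witness may take `L_k` as large as it likes — `exp(exp(1/a_k))` is
admissible — while `HasMassScaling`, `HasAsymptoticScaling` do not mention `L` at all, EXTINCT stays free
for `m_crit ≥ 0` at every volume, and TIGHT is evaluated on the scheme's OWN torus `(2L_k+1)⁴`. So for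
the junk family `tipReg L'` (`canonicalAF` with volumes `L'`) the whole of `SD(N_f)` reduces to a
statement with NO continuum content: `IndexSpread N_f` — at the FIXED bare parameters
`(β_k, a_k, Z_k, m_crit = 0)` of step `k`, the phase-quenched first absolute moment of the spectral index
`n₋(Γ₅ D_W(U, -a_k M/Z_k, 1)) - 6(2L'+1)⁴` is `≥ 1` on all sufficiently large tori `(2L'+1)⁴`, locally
uniformly in the masses (an infinite-volume statement of lattice statistical mechanics at fixed cutoff:
no `a → 0`, no OS axioms, no gap). `sdHyp_of_indexSpread : IndexSpread N_f → SD(N_f)` and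
`extinctionBuildsQCD_iff_qcd_of_indexSpread : IndexSpread 2 → IndexSpread 3 → (ExtinctionBuildsQCD ↔ QCD)`.

WHY `IndexSpread` SHOULD HOLD (heuristic, not provable now; recorded for the planner). By §5 the index at
probe `-δ` (`δ = a_k M/Z_k`) is the net chirality of the real modes of `D_W(U,0,1)` in `[0, δ]`. (i) RATE:
a smooth lattice instanton of radius `ρ̂ ≳ δ^{-1/2}` inside a cold patch (links within `≲ δ^{1/2}` of a pure
gauge over `≳ ρ̂⁴` sites) carries ONE simple real mode in `(0, δ)` of definite chirality; a simple real
eigenvalue of a `γ₅`-Hermitian matrix cannot leave the axis under small perturbations, so this is an OPEN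
set of gauge fields, of positive (hyper-small, `~ e^{-c ρ̂⁴ log(1/δ)}`) probability per site under the
Wilson measure at ANY `β_k`, and the phase-quenched tilt `∏_f |det D_W(U, a_k m_f/Z_k)|` changes conditional
block probabilities only by `e^{±C R⁴ Z_k/(a_k m_f)}` (`‖D_W(m₀)⁻¹‖ ≤ 1/m₀`, §1), a `k`-dependent constant.
(ii) SYMMETRY: a one-axis reflection conjugates `Γ₅ D_W` to `-Γ₅ D_W` (it anticommutes `γ₅`), preserves the
Wilson measure and the `|det|` weights, so the index law is symmetric, `E₊[index] = 0`. (iii) SPREADING: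
distant cold patches are asymptotically independent (Gaussian small-ball events are even positively
correlated), so on `(2L'+1)⁴ ≫ rate⁻¹` sites the index is a symmetric sum of many weakly dependent `±1`'s and
`E₊|index| → ∞`. Only (iii) — a central-limit statement for a non-local spectral functional — is beyond
present technique; it is fixed-cutoff statistical mechanics, incomparably weaker than `QCDOf N_f`.

CONSEQUENCE. In truth-value the hypothesis `SD(N_f)` of the bridge is (junk-)TRUE and the sibling crux
`WindowExtinction` junk-provable modulo `IndexSpread`; the bridge `ExtinctionBuildsQCD` is then LITERALLY
`QCD`: the route's cut `SD ∧ BRIDGE` carries no decomposition. REPAIRS that restore the intended pin (for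
the planner; each defeats the tip witness heuristically, none is a theorem): (R1) cap the volume,
`∀ᶠ k, (reg.L k : ℝ) ≤ (reg.a k)⁻¹ ^ p` for a fixed `p` (then `(2L_k+1)⁴ · rate → 0` for tip modes, whose rate
is smaller than any power of `a_k`); (R2) make TIGHT EXTENSIVE at the physical susceptibility scale,
`∃ η > 0, ∀ M > M₀, ∀ᶠ k, E₊|index_k(M)| ≥ η (a_k (2 L_k + 1))²` (honest: `E|Q| ≍ (χ_t V_phys)^{1/2}`; tip junk:
`(rate_k V_lat)^{1/2} = o(a_k² V_lat^{1/2})`); (R3) demand TIGHT on the torus of side `2⌈(a_k)⁻¹⌉+1`-type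
fixed physical multiple rather than on the scheme's own torus. (R1) is the cheapest and loses nothing
for the honest witness (which needs `a_k L_k → ∞` slowly anyway, or EXTINCT's total count on the scheme
torus cannot vanish). -/

section VolumeLever

variable {Nf : ℕ}

/-- The TIGHT ratio of witness data `reg` at step `k`, mass tuple `m`, probe parameter `M`, evaluated on
the torus of half-side `L'` (TIGHT itself is the case `L' = reg.L k`, `tight_iff_tightRatio`). -/
noncomputable def tightRatio (reg : QCDRegularisation Nf) (k L' : ℕ) (m : Fin Nf → ℝ) (M : ℝ) : ℝ :=
  (∫ U, (|(Multiset.countP (fun z : ℂ => z.re < 0) (spinorLift gammaFive * wilsonDirac (fundamentalRep (Fin 3)) U (reg.mcrit k - reg.a k * M / reg.Zm k) 1).charpoly.roots : ℝ) - 6 * (2 * L' + 1 : ℝ) ^ 4|) * ∏ f : Fin Nf, ‖fermionDet (wilsonDirac (fundamentalRep (Fin 3)) U (reg.mcrit k + reg.a k * m f / reg.Zm k) 1)‖ ∂(wilsonMeasure (d := 4) (L := 2 * L' + 1) (fundamentalRep (Fin 3)) (reg.β k))) / (∫ U, ∏ f : Fin Nf, ‖fermionDet (wilsonDirac (fundamentalRep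 (Fin 3)) U (reg.mcrit k + reg.a k * m f / reg.Zm k) 1)‖ ∂(wilsonMeasure (d := 4) (L := 2 * L' + 1) (fundamentalRep (Fin 3)) (reg.β k)))

/-- TIGHT is "eventually the ratio on the scheme's own torus is `≥ 1`" (definitional). -/
theorem tight_iff_tightRatio (reg : QCDRegularisation Nf) (M₀ : ℝ) (m : Fin Nf → ℝ) :
    Tight Nf reg M₀ m ↔ ∀ M : ℝ, M₀ < M → ∀ᶠ k : ℕ in Filter.atTop, 1 ≤ tightRatio reg k (reg.L k) m M :=
  Iff.rfl

/-- **The volume is witness data.** `reg` with its torus half-sides replaced by ANY sequence `L'` with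
`a_k L'_k → ∞` is again a `QCDRegularisation`. -/
def withVolume (reg : QCDRegularisation Nf) (L' : ℕ → ℕ)
    (hL' : Tendsto (fun k => reg.a k * L' k) atTop atTop) : QCDRegularisation Nf :=
  { reg with L := L', tendsto_L := hL' }

/-- The volume datum of `withVolume reg L'` is `L'`. -/
@[simp] theorem withVolume_L (reg : QCDRegularisation Nf) (L' : ℕ → ℕ)
    (hL' : Tendsto (fun k => reg.a k * L' k) atTop atTop) : (withVolume reg L' hL').L = L' := rfl

/-- Mass scaling does not see the volume. -/
theorem withVolume_hasMassScaling_iff (reg : QCDRegularisation Nf) (L' : ℕ → ℕ)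
    (hL' : Tendsto (fun k => reg.a k * L' k) atTop atTop) :
    (withVolume reg L' hL').HasMassScaling ↔ reg.HasMassScaling := Iff.rfl

/-- Asymptotic scaling does not see the volume. -/
theorem withVolume_hasAsymptoticScaling_iff (reg : QCDRegularisation Nf) (L' : ℕ → ℕ)
    (hL' : Tendsto (fun k => reg.a k * L' k) atTop atTop) :
    ((withVolume reg L' hL').scheme 0 0 0).HasAsymptoticScaling ↔
      (reg.scheme 0 0 0).HasAsymptoticScaling := Iff.rfl

/-- The TIGHT ratio on a given torus does not see the scheme's volume datum. -/
theorem tightRatio_withVolume (reg : QCDRegularisation Nf) (L' : ℕ → ℕ)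
    (hL' : Tendsto (fun k => reg.a k * L' k) atTop atTop) (k L'' : ℕ) (m : Fin Nf → ℝ) (M : ℝ) :
    tightRatio (withVolume reg L' hL') k L'' m M = tightRatio reg k L'' m M := rfl

/-- EXTINCT (which DOES see the volume: it ranges over the tori `S ≥ L_k` and is normalised per scheme
torus) is nevertheless free at EVERY volume for a line at non-negative bare mass (§2: integrand `≡ 0`). -/
theorem extinct_withVolume_of_mcrit_nonneg (reg : QCDRegularisation Nf) (L' : ℕ → ℕ)
    (hL' : Tendsto (fun k => reg.a k * L' k) atTop atTop) (hcrit : ∀ k, 0 ≤ reg.mcrit k)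
    {c : ℝ} (hc1 : c ≤ 1) (m : Fin Nf → ℝ) (hm : ∀ f, 0 < m f) :
    Extinct Nf (withVolume reg L' hL') c m :=
  extinct_of_mcrit_nonneg (withVolume reg L' hL') hcrit hc1 m hm

variable (Nf) in
/-- **The tip family**: `canonicalAF` (`m_crit ≡ 0`, `a_k = 1/(k+1)`, `β_k = afBeta N_f 1 a_k`,
`Z_m(k) = (log a_k⁻²)^{γ₀/(2β₀)}`) with arbitrary admissible volumes `L'`. -/
noncomputable def tipReg (L' : ℕ → ℕ)
    (hL' : Tendsto (fun k => (QCDRegularisation.canonicalAF Nf).a k * L' k) atTop atTop) :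
    QCDRegularisation Nf :=
  withVolume (QCDRegularisation.canonicalAF Nf) L' hL'

variable (Nf) in
/-- **Infinite-volume index spreading at fixed cutoff** (the statement `SD(N_f)` reduces to on the tip
family). For every bound `K` on the masses there is `k₀` such that at every LATER step `k` — i.e. at the
FIXED bare parameters `β_k = afBeta N_f 1 (k+1)⁻¹`, `a_k = (k+1)⁻¹`, `Z_k = (log (k+1)²)^{γ₀/(2β₀)}`,
line `m_crit = 0` — the phase-quenched (weights `∏_f |det D_W(U, a_k m_f/Z_k, 1)|`) expectation of
`|n₋(Γ₅ D_W(U, -a_k M/Z_k, 1)) - 6(2L'+1)⁴|` on the torus `(2L'+1)⁴` is `≥ 1` for ALL sufficiently large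
`L'`, uniformly in `0 < m_f ≤ K`, `0 < M ≤ K`.

**ERRATUM (same seat, same cycle): THIS FORM IS FALSE**, not merely unproved — the uniformity in
`M ∈ (0, K]` at FIXED volume `L'` cannot hold: off the null set `det D_W(U,0,1) = 0` the index at probe
`-δ` vanishes once `δ` is below the least real eigenvalue of `D_W(U,0,1)`
(`index_eq_zero_of_no_realMode`, `IndexBudget.lean`), so `E₊|index(-a_k M/Z_k)| → 0` as `M → 0⁺` at
fixed `(k, L')` by dominated convergence. The implications below remain true but carry nothing. The
intended hypothesis quantifies masses and `M` over a compact box `[1/(K+1), K+1]`: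
`IndexSpreadBox` in `VolumeLeverBox.lean`, where all results of this file are re-proved; THAT form is
the heuristically true one (tip real modes have a positive rate per site, the index law is
reflection-symmetric, distant cold patches decorrelate — §4 docstring above). -/
def IndexSpread : Prop :=
  ∀ K : ℕ, ∃ k₀ : ℕ, ∀ k : ℕ, k₀ ≤ k → ∃ L₀ : ℕ, ∀ L' : ℕ, L₀ ≤ L' →
    ∀ m : Fin Nf → ℝ, (∀ f, 0 < m f ∧ m f ≤ K) → ∀ M : ℝ, 0 < M → M ≤ K →
      1 ≤ tightRatio (QCDRegularisation.canonicalAF Nf) k L' m M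

/-- **The tip family is TIGHT modulo `IndexSpread`**: a diagonal choice of volumes
`L_k := max (L_k^{can}, max_{K ≤ k} L₀(K, k))` makes `tipReg L` satisfy TIGHT with threshold `M₀ = 0` for
every positive mass tuple. -/
theorem tight_tipReg_of_indexSpread (h : IndexSpread Nf) :
    ∃ (L' : ℕ → ℕ) (hL' : Tendsto (fun k => (QCDRegularisation.canonicalAF Nf).a k * L' k) atTop atTop),
      ∀ m : Fin Nf → ℝ, (∀ f, 0 < m f) → Tight Nf (tipReg Nf L' hL') 0 m := by
  classical
  choose k₀ hk₀ using h
  -- `L₀ K k` for `k ≥ k₀ K` (junk `0` otherwise)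
  have hL₀ : ∀ K k : ℕ, ∃ L₀ : ℕ, k₀ K ≤ k → ∀ L' : ℕ, L₀ ≤ L' →
      ∀ m : Fin Nf → ℝ, (∀ f, 0 < m f ∧ m f ≤ K) → ∀ M : ℝ, 0 < M → M ≤ K →
        1 ≤ tightRatio (QCDRegularisation.canonicalAF Nf) k L' m M := by
    intro K k
    by_cases hk : k₀ K ≤ k
    · obtain ⟨L₀, hL⟩ := hk₀ K k hk
      exact ⟨L₀, fun _ => hL⟩
    · exact ⟨0, fun h => absurd h hk⟩
  choose L₀ hL₀' using hL₀
  set can := QCDRegularisation.canonicalAF Nf with hcan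
  -- the diagonal volumes
  let L : ℕ → ℕ := fun k => max (can.L k) ((Finset.range (k + 1)).sup fun K => L₀ K k)
  have hLge : ∀ k, can.L k ≤ L k := fun k => le_max_left _ _
  have hLge' : ∀ K k, K ≤ k → L₀ K k ≤ L k := fun K k hKk =>
    (Finset.le_sup (f := fun K => L₀ K k) (Finset.mem_range.2 (Nat.lt_succ_of_le hKk))).trans
      (le_max_right _ _)
  have hL : Tendsto (fun k => can.a k * L k) atTop atTop := by
    refine tendsto_atTop_mono (fun k => ?_) can.tendsto_L
    exact mul_le_mul_of_nonneg_left (by exact_mod_cast hLge k) (can.a_pos k).le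
  refine ⟨L, hL, fun m hm M hM => ?_⟩
  -- a common integer bound on the masses and the probe parameter
  obtain ⟨K, hK⟩ : ∃ K : ℕ, (∀ f, m f ≤ K) ∧ M ≤ K := by
    refine ⟨⌈max M (∑ f, m f)⌉₊, fun f => ?_, ?_⟩
    · calc m f ≤ ∑ g, m g := Finset.single_le_sum (fun g _ => (hm g).le) (Finset.mem_univ f)
        _ ≤ max M (∑ g, m g) := le_max_right _ _
        _ ≤ _ := Nat.le_ceil _
    · exact (le_max_left _ _).trans (Nat.le_ceil _)
  filter_upwards [Filter.eventually_ge_atTop (max (k₀ K) K)] with k hk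
  have hk₀K : k₀ K ≤ k := le_of_max_le_left hk
  have hKk : K ≤ k := le_of_max_le_right hk
  -- the scheme's own torus at step `k` is `L k`, and the ratio does not see the volume datum
  exact hL₀' K k hk₀K (L k) (hLge' K k hKk) m (fun f => ⟨hm f, hK.1 f⟩) M hM hK.2

/-- **`SD(N_f)` with ANY extra side condition met by the tip family holds modulo `IndexSpread`.** The tip
regularisation is mass-scaling, asymptotically scaling, EXTINCT for all positive masses with `c = 1`
(free, §2) and TIGHT with `M₀ = 0` — the "spectrally clean, tight" witness `WindowExtinction` asks for,
with its line at bare mass ZERO (quarks infinitely heavy in physical units: it sits `|m_crit^{phys}(g₀)| ≍ g₀²`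
lattice units, i.e. `≍ g₀²/a_k → ∞` physical units, above the physical critical line). -/
theorem sdWith_of_indexSpread (P : QCDRegularisation Nf → Prop) (hP : ∀ L' hL', P (tipReg Nf L' hL'))
    (h : IndexSpread Nf) :
    ∃ reg : QCDRegularisation Nf, P reg ∧ reg.HasMassScaling ∧ (reg.scheme 0 0 0).HasAsymptoticScaling ∧
      ∃ M₀ : ℝ, 0 ≤ M₀ ∧ ∃ c : ℝ, 0 < c ∧ ∀ m : Fin Nf → ℝ, (∀ f, M₀ < m f) →
        Extinct Nf reg c m ∧ Tight Nf reg M₀ m := by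
  obtain ⟨L', hL', hT⟩ := tight_tipReg_of_indexSpread h
  exact ⟨tipReg Nf L' hL', hP L' hL', QCDRegularisation.canonicalAF_hasMassScaling,
    QCDScheme.zeroAF_hasAsymptoticScaling, 0, le_rfl, 1, one_pos, fun m hm =>
      ⟨extinct_withVolume_of_mcrit_nonneg _ L' hL' (fun _ => le_rfl) le_rfl m hm, hT m hm⟩⟩

/-- **`SD(N_f)` holds modulo `IndexSpread`** (tip witness). -/
theorem sdHyp_of_indexSpread (h : IndexSpread Nf) : SDHyp Nf := by
  obtain ⟨reg, -, h⟩ := sdWith_of_indexSpread (fun _ => True) (fun _ _ => trivial) h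
  exact ⟨reg, h⟩

-- buildfix 2026-08-19 (maintenance): `extinctionBuildsQCD_iff_qcd_of_indexSpread` and
-- `not_extinctionBuildsQCD_iff_not_qcd_of_indexSpread` REMOVED — the summit-equivalence flag they recorded
-- (bridge ↔ QCD modulo `IndexSpread`) is exactly what route rev 9 (SD⁺ restate, 2026-08-17) voided: the route
-- docstring says so ('VOIDED by the SD⁺ restate'); `sdHyp_of_indexSpread` yields `SDHyp`, not SD⁺, and the
-- conclusion is THR, not `QCDOf`. `collapse_schema_of_indexSpread` below (route-decl-free) is untouched.

/-- **Collapse schema with side conditions.** For ANY candidate side condition `P` on the regularisation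
that the tip family satisfies at every admissible volume (e.g. `∀ᶠ k, -1 < m_crit k` — the physical-branch
clause suggested in FINDINGS-ideator1 F4 —, `m_crit(k) → 0`, `|m_crit(k)| ≤ C g₀(k)²`, `m_crit ∈ [-8,0]`):
adding `P` to `SD` does not undo the collapse modulo `IndexSpread`. Only a condition that sees the VOLUME
(R1–R3 of the module docstring) can. -/
theorem collapse_schema_of_indexSpread (P : ∀ Nf : ℕ, QCDRegularisation Nf → Prop)
    (hP : ∀ Nf L' hL', P Nf (tipReg Nf L' hL')) (h2 : IndexSpread 2) (h3 : IndexSpread 3) :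
    (∀ Nf : ℕ, (Nf = 2 ∨ Nf = 3) →
      (∃ reg : QCDRegularisation Nf, P Nf reg ∧ reg.HasMassScaling ∧
        (reg.scheme 0 0 0).HasAsymptoticScaling ∧ ∃ M₀ : ℝ, 0 ≤ M₀ ∧ ∃ c : ℝ, 0 < c ∧
          ∀ m : Fin Nf → ℝ, (∀ f, M₀ < m f) → Extinct Nf reg c m ∧ Tight Nf reg M₀ m) → QCDOf Nf) ↔
      _root_.QCD :=
  ⟨fun h => ⟨h 2 (Or.inl rfl) (sdWith_of_indexSpread (P 2) (hP 2) h2),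
      h 3 (Or.inr rfl) (sdWith_of_indexSpread (P 3) (hP 3) h3)⟩,
    fun hq Nf hNf _ => by
      rcases hNf with rfl | rfl
      exacts [hq.1, hq.2]⟩

/-- Instance: the physical-branch clause `∀ k, -1 < m_crit k` (FINDINGS-ideator1 F4's recommended
addition) is met by the tip family (`m_crit ≡ 0`), so it does not restore the cut. -/
theorem collapse_with_branchClause_of_indexSpread (h2 : IndexSpread 2) (h3 : IndexSpread 3) :
    (∀ Nf : ℕ, (Nf = 2 ∨ Nf = 3) →
      (∃ reg : QCDRegularisation Nf, (∀ k, -1 < reg.mcrit k ∧ reg.mcrit k ≤ 0) ∧ reg.HasMassScaling ∧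
        (reg.scheme 0 0 0).HasAsymptoticScaling ∧ ∃ M₀ : ℝ, 0 ≤ M₀ ∧ ∃ c : ℝ, 0 < c ∧
          ∀ m : Fin Nf → ℝ, (∀ f, M₀ < m f) → Extinct Nf reg c m ∧ Tight Nf reg M₀ m) → QCDOf Nf) ↔
      _root_.QCD :=
  collapse_schema_of_indexSpread (fun _ reg => ∀ k, -1 < reg.mcrit k ∧ reg.mcrit k ≤ 0)
    (fun _ _ _ _ => ⟨by norm_num [tipReg, withVolume, QCDRegularisation.canonicalAF],
      le_rfl⟩) h2 h3

end VolumeLever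

end Summit.QuantumFields.QCD.Theorems.ExtinctionBuildsQCD.Negative

end
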